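import Summits.BirchSwinnertonDyer.BirchSwinnertonDyer.Theorems.SignedLowerHalvesSmallImageCharSignedSelmerSatDefs
import Literature.NumberTheory.EllipticCurves.IwasawaDualModuleCoeff
import Literature.NumberTheory.EllipticCurves.BigRepModuleShapiroDualityProofs
import Literature.NumberTheory.EllipticCurves.SharpFlatPAdicLFunctionCoeffField
import HarnessLib

/-!
# Route `SignedLowerHalves`, crux L `SmallImageLowerHalfBothSigns` (stmt-BirchSwinnertonDyer-23599), line `rtt_w3` v13 — E2, row D2-seq (1′), LEAD:
# THE `Λ_𝒪`-STRUCTURE OF THE STUB'S DUAL `Dψ.X` — `X' := Dψ.X` IS A `Λ_𝒪 = 𝒪⟦T⟧`-MODULE EXTENDING ITS `Λ`-STRUCTURE, WITH `C a` ACTING AS THE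
# TRANSPOSE OF `scalarH1 a`

WHY (BRIEF-E2 rev 3.1 §2 row `X'`, `Lines/rtt_w3-BRIEF-E2-g9b.md`). The glue `charRoad_E2_of_localisation` (p776213) takes `X'` a `Λ_𝒪 = IwasawaAlgebraO S`-module whose
`Λ = ℤ_p⟦T⟧`-structure (through `iwasawaToIwasawaO S`) is the one in which `λ` is read; the stub's `Dψ : SignedTransportDualDataSat κ γ M 𝒪 V j S₀ ε` carries
only a `Λ`-structure (`T ↦ conj_γ − 1`, constants through `ℤ_p → ℤ/p^k`). This file PROVES that `Dψ.X` carries a `Λ_𝒪`-structure EXTENDING it, with the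
constants `C a`, `a ∈ 𝒪`, acting as the transpose of the scalar action `scalarH1 a` of `𝒪` on `Sel^{ε,S₀,sat}_𝒪(K_∞, M)` — so `X' := Dψ.X` in the glue,
with NO comparison map and with `lambdaInvariant p X' ≡ lambdaInvariant p Dψ.X` by `rfl`:
* `toDual_smul_eq_smulFun` — the `Λ`-action of ANY saturated dual datum read through `toDual` is the canonical finite sum `IsLocNil.smulFun`
  (FORCING: tree `IwasawaDual.IsLocNil.map_smul_eq_smulFun`);
* `smul_eq_val_smul_of_pow_smul_eq_zero` — on a `p^k`-torsion element of an `𝒪`-module, `ι₀(c) ∈ 𝒪` (`c ∈ ℤ_p`) acts as `(c mod p^k)`;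
* ★★ `exists_moduleO_signedTransportDualDataSat` — `∃ inst : Module (IwasawaAlgebraO S) Dψ.X` with `(iwasawaToIwasawaO S f) • x = f • x` and
  `toDual ((C a) • x) s = toDual x (scalarH1 a s)` (the structure is the tree's `IwasawaDualCoeff.exists_module` on `Hom(Sel, ℚ/ℤ)` for
  `σ = scalarH1`, `ψ = conj_γ − 1`, transported along the bijection `toDual`).
THEOREMS ONLY (an `∃` over structures; install with `obtain ⟨inst, hΛ, hC⟩ := …; letI := inst`); nothing about E2 itself is proved; crux L, crux M, E2 and BSD remain
OPEN and are proved for NO curve by any of this. [cite: EmertonPollackWeston2006, §3.1] [cite: GreenbergLNM1716, §1 (after Conj. 1.3)] [cite: Washington1997, §13.2]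
-/

set_option autoImplicit false
set_option linter.dupNamespace false -- D-0017: single-problem summit, the namespace repeats the problem name by design

noncomputable section

open scoped Classical
open NumberField IsDedekindDomain Field

universe u

namespace Summit.BirchSwinnertonDyer.BirchSwinnertonDyer.Theorems.SmallImageCharSignedSelmer

open Literature.NumberTheory.EllipticCurves Literature.NumberTheory.EllipticCurves.GreenbergSelmer

/-! ## §1. Forcing: the `Λ`-action of a saturated dual datum is the canonical one -/

section Forcing

variable {K : Type u} [Field K] [NumberField K] {p : ℕ} [Fact p.Prime] {κ : ZpExtension K p}
  {M : Type u} [AddCommGroup M] [DistribMulAction (absoluteGaloisGroup K) M] [TopologicalSpace M] [DiscreteTopology M]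
  {R : Type*} [Ring R] [Module R M]
  {V : WeierstrassCurve K} {j : V.geomPrimaryTorsion p →+ M} {S₀ : Set (HeightOneSpectrum (𝓞 K))} {ε : ℤˣ}
  {γ : absoluteGaloisGroup K} (D : SignedTransportDualDataSat κ γ M R V j S₀ ε)

/-- **The `Λ`-action of `Dψ` is forced**: for every saturated dual datum `D`, `toDual (f • x) = f ⋆ toDual x` with `⋆` the canonical finite-sum action
`IsLocNil.smulFun` attached to `ψ = conj_γ − 1` (`M` `p`-primary with open stabilisers, `γ` a topological generator) — from `toDual_T_smul`,
`toDual_C_smul` by the tree's forcing lemma `IwasawaDual.IsLocNil.map_smul_eq_smulFun`. [cite: GreenbergLNM1716, §1 (after Conj. 1.3)] -/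
theorem toDual_smul_eq_smulFun (htor : ∀ m : M, ∃ k : ℕ, p ^ k • m = 0)
    (hstab : ∀ m : M, IsOpen (MulAction.stabilizer (absoluteGaloisGroup K) m : Set (absoluteGaloisGroup K)))
    (hγ : κ.IsTopGenerator γ) (f : IwasawaAlgebra p) (x : D.X) :
    D.toDual (f • x) = (isLocNil_conjSignedSat_sub_one κ R V j S₀ ε htor hstab hγ).smulFun f (D.toDual x) :=
  (isLocNil_conjSignedSat_sub_one κ R V j S₀ ε htor hstab hγ).map_smul_eq_smulFun D.toDual
    (fun x s ↦ by
      rw [D.toDual_T_smul x s, IwasawaDual.End_sub_apply, AddMonoid.End.one_apply, map_sub]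
      rfl)
    (fun c x s k hk ↦ D.toDual_C_smul c x s k hk) f x

end Forcing

/-! ## §2. `ℤ_p ⊂ 𝒪` acts on `p^k`-torsion through `ℤ/p^k` -/

/-- In an `𝒪`-module (`𝒪` any ring with `ι₀ : ℤ_p → 𝒪`), if `p^k · y = 0` then `ι₀(c) · y = (c mod p^k) · y` (`c = n + p^k u`, `PadicInt.ker_toZModPow`).
[cite: Lang1990, Ch. 5 §1] -/
theorem smul_eq_val_smul_of_pow_smul_eq_zero {p : ℕ} [Fact p.Prime] {O : Type*} [Ring O] (ι₀ : ℤ_[p] →+* O) {Y : Type*} [AddCommGroup Y]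
    [Module O Y] (c : ℤ_[p]) {y : Y} {k : ℕ} (hy : p ^ k • y = 0) :
    ι₀ c • y = (PadicInt.toZModPow k c).val • y := by
  haveI : NeZero (p ^ k) := ⟨pow_ne_zero _ (Fact.out : p.Prime).ne_zero⟩
  set n : ℕ := (PadicInt.toZModPow k c).val with hn
  have hmem : c - (n : ℤ_[p]) ∈ RingHom.ker (PadicInt.toZModPow k) := by
    rw [RingHom.mem_ker, map_sub, map_natCast, hn, ZMod.natCast_zmod_val, sub_self]
  rw [PadicInt.ker_toZModPow, Ideal.mem_span_singleton] at hmem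
  obtain ⟨u, hu⟩ := hmem
  have hc : c = (n : ℤ_[p]) + u * (p : ℤ_[p]) ^ k := by linear_combination hu
  rw [hc, map_add, map_natCast, map_mul, map_pow, map_natCast, add_smul, mul_smul, ← Nat.cast_pow, Nat.cast_smul_eq_nsmul,
    Nat.cast_smul_eq_nsmul, hy, smul_zero, add_zero]

section ScalarH1

variable {G : Type u} [Group G] [TopologicalSpace G] [IsTopologicalGroup G] (H : Subgroup G)
  (M : Type u) [AddCommGroup M] [DistribMulAction G M] [TopologicalSpace M] [DiscreteTopology M]
  {R : Type*} [Ring R] [Module R M] [SMulCommClass G R M]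

/-- `scalarH1 (n : R)` is multiplication by `n` on `H¹(H, M)` (`scalarH1_add`, `scalarH1_one`, `scalarH1_zero`). [folklore] -/
theorem scalarH1_natCast_apply' (n : ℕ) (s : subgroupH1 H M) : scalarH1 H M (n : R) s = n • s := by
  induction n with
  | zero => rw [Nat.cast_zero, scalarH1_zero, AddMonoidHom.zero_apply, zero_smul]
  | succ n ih => rw [Nat.cast_succ, scalarH1_add, AddMonoidHom.add_apply, ih, scalarH1_one, AddMonoidHom.id_apply, add_smul, one_smul]

/-- On a `p^k`-torsion class, the scalar `ι₀(c) ∈ R` (`c ∈ ℤ_p`) acts as `(c mod p^k)`: `scalarH1 (ι₀ c) s = (c mod p^k) • s`. [cite: Lang1990, Ch. 5 §1] -/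
theorem scalarH1_padicInt_apply_of_pow_smul_eq_zero {p : ℕ} [Fact p.Prime] (ι₀ : ℤ_[p] →+* R) (c : ℤ_[p])
    {s : subgroupH1 H M} {k : ℕ} (hs : p ^ k • s = 0) :
    scalarH1 H M (ι₀ c) s = (PadicInt.toZModPow k c).val • s := by
  haveI : NeZero (p ^ k) := ⟨pow_ne_zero _ (Fact.out : p.Prime).ne_zero⟩
  set n : ℕ := (PadicInt.toZModPow k c).val with hn
  have hmem : c - (n : ℤ_[p]) ∈ RingHom.ker (PadicInt.toZModPow k) := by
    rw [RingHom.mem_ker, map_sub, map_natCast, hn, ZMod.natCast_zmod_val, sub_self]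
  rw [PadicInt.ker_toZModPow, Ideal.mem_span_singleton] at hmem
  obtain ⟨u, hu⟩ := hmem
  have hc : c = (n : ℤ_[p]) + u * (p : ℤ_[p]) ^ k := by linear_combination hu
  rw [hc, map_add, map_natCast, map_mul, map_pow, map_natCast, scalarH1_add, AddMonoidHom.add_apply, scalarH1_natCast_apply',
    scalarH1_mul, AddMonoidHom.comp_apply, ← Nat.cast_pow, scalarH1_natCast_apply', hs, map_zero, add_zero]

end ScalarH1

/-! ## §3. The `Λ_𝒪`-structure of `Dψ.X` -/

section Structure

variable {K : Type u} [Field K] [NumberField K] {p : ℕ} [Fact p.Prime] {κ : ZpExtension K p}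
  {S : Set (PadicAlgCl p)}
  {M : Type u} [AddCommGroup M] [DistribMulAction (absoluteGaloisGroup K) M] [TopologicalSpace M] [DiscreteTopology M]
  [Module (padicCoeffIntegers S) M] [SMulCommClass (absoluteGaloisGroup K) (padicCoeffIntegers S) M]
  {V : WeierstrassCurve K} {j : V.geomPrimaryTorsion p →+ M} {S₀ : Set (HeightOneSpectrum (𝓞 K))} {ε : ℤˣ}
  {γ : absoluteGaloisGroup K} (D : SignedTransportDualDataSat κ γ M (padicCoeffIntegers S) V j S₀ ε)

/-- **`X' := Dψ.X` is a `Λ_𝒪`-module.** For a saturated dual datum `Dψ` with scalars `𝒪 = padicCoeffIntegers S` (`M` `p`-primary with open stabilisers and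
`𝒪`-linear Galois action, `γ` a topological generator): there is a `Module (IwasawaAlgebraO S) Dψ.X` such that (i) its restriction along the coefficientwise
`iwasawaToIwasawaO S : Λ → Λ_𝒪` IS the given `Λ`-structure, `(iwasawaToIwasawaO S f) • x = f • x`, and (ii) the constant `C a` (`a ∈ 𝒪`) acts as the
TRANSPOSE of `scalarH1 a` on `Sel^{ε,S₀,sat}_𝒪(K_∞, M)`: `toDual ((C a) • x) s = toDual x (scalarH1 a s)`. Construction: the tree's `IwasawaDualCoeff.exists_module`
on `Hom(Sel, ℚ/ℤ)` for `σ = scalarH1` (a ring action: `scalarH1_one/_mul/_add/_zero`) and `ψ = conj_γ − 1` (commuting: `conjH1_comp_scalarH1`), transported along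
the bijection `toDual`; (i) because both `Λ`-actions read through `toDual` are forced to be `IsLocNil.smulFun` (§1 and the forcing lemma for the restricted
structure, the constants of `ℤ_p ⊂ 𝒪` acting through `ℤ/p^k` by §2). [cite: EmertonPollackWeston2006, §3.1] [cite: GreenbergLNM1716, §1 (after Conj. 1.3)] -/
theorem exists_moduleO_signedTransportDualDataSat (htor : ∀ m : M, ∃ k : ℕ, p ^ k • m = 0)
    (hstab : ∀ m : M, IsOpen (MulAction.stabilizer (absoluteGaloisGroup K) m : Set (absoluteGaloisGroup K)))
    (hγ : κ.IsTopGenerator γ) :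
    ∃ inst : Module (IwasawaAlgebraO S) D.X,
      (∀ (f : IwasawaAlgebra p) (x : D.X), (letI := inst; iwasawaToIwasawaO S f • x) = f • x) ∧
      (∀ (a : padicCoeffIntegers S) (x : D.X) (s : signedTransportSelmerInftySat κ M (padicCoeffIntegers S) V j S₀ ε),
        D.toDual (letI := inst; (PowerSeries.C a : IwasawaAlgebraO S) • x) s =
          D.toDual x ⟨scalarH1 κ.kerSubgroup M a s, scalarH1_mem_signedTransportSelmerInftySat κ M (padicCoeffIntegers S) V j S₀ ε a s.2⟩) := by
  -- notation
  set Sel := signedTransportSelmerInftySat κ M (padicCoeffIntegers S) V j S₀ ε with hSel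
  have hnil := isLocNil_conjSignedSat_sub_one κ (padicCoeffIntegers S) V j S₀ ε htor hstab hγ
  set ψ : AddMonoid.End Sel := conjSignedSat κ M (padicCoeffIntegers S) V j S₀ ε γ - 1 with hψ
  -- the scalar action of `𝒪` on `Sel`, as a ring action
  let σ₀ : padicCoeffIntegers S → AddMonoid.End Sel := fun a ↦
    ((scalarH1 κ.kerSubgroup M a).comp Sel.subtype).codRestrict Sel fun s ↦
      scalarH1_mem_signedTransportSelmerInftySat κ M (padicCoeffIntegers S) V j S₀ ε a s.2
  have σ₀_apply : ∀ (a : padicCoeffIntegers S) (s : Sel), ((σ₀ a s : Sel) : subgroupH1 κ.kerSubgroup M) = scalarH1 κ.kerSubgroup M a s :=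
    fun _ _ ↦ rfl
  let σ : padicCoeffIntegers S →+* AddMonoid.End Sel :=
    { toFun := σ₀
      map_one' := by
        refine AddMonoidHom.ext fun s ↦ Subtype.ext ?_
        change scalarH1 κ.kerSubgroup M (1 : padicCoeffIntegers S) (s : subgroupH1 κ.kerSubgroup M) = (s : subgroupH1 κ.kerSubgroup M)
        rw [scalarH1_one, AddMonoidHom.id_apply]
      map_mul' := fun a b ↦ by
        refine AddMonoidHom.ext fun s ↦ Subtype.ext ?_
        change scalarH1 κ.kerSubgroup M (a * b) (s : subgroupH1 κ.kerSubgroup M) =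
          scalarH1 κ.kerSubgroup M a (scalarH1 κ.kerSubgroup M b (s : subgroupH1 κ.kerSubgroup M))
        rw [scalarH1_mul, AddMonoidHom.comp_apply]
      map_zero' := by
        refine AddMonoidHom.ext fun s ↦ Subtype.ext ?_
        change scalarH1 κ.kerSubgroup M (0 : padicCoeffIntegers S) (s : subgroupH1 κ.kerSubgroup M) = 0
        rw [scalarH1_zero, AddMonoidHom.zero_apply]
      map_add' := fun a b ↦ by
        refine AddMonoidHom.ext fun s ↦ Subtype.ext ?_
        change scalarH1 κ.kerSubgroup M (a + b) (s : subgroupH1 κ.kerSubgroup M) =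
          scalarH1 κ.kerSubgroup M a (s : subgroupH1 κ.kerSubgroup M) + scalarH1 κ.kerSubgroup M b (s : subgroupH1 κ.kerSubgroup M)
        rw [scalarH1_add, AddMonoidHom.add_apply] }
  have σ_apply : ∀ (a : padicCoeffIntegers S) (s : Sel), ((σ a s : Sel) : subgroupH1 κ.kerSubgroup M) = scalarH1 κ.kerSubgroup M a s :=
    fun _ _ ↦ rfl
  -- `ψ` commutes with the scalars
  have hcomm : ∀ a : padicCoeffIntegers S, ψ * σ a = σ a * ψ := fun a ↦ by
    refine AddMonoidHom.ext fun s ↦ Subtype.ext ?_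
    change ((ψ (σ a s) : Sel) : subgroupH1 κ.kerSubgroup M) = ((σ a (ψ s) : Sel) : subgroupH1 κ.kerSubgroup M)
    rw [hψ, IwasawaDual.End_sub_apply, IwasawaDual.End_sub_apply, AddMonoid.End.one_apply, AddMonoid.End.one_apply,
      AddSubgroupClass.coe_sub, map_sub, AddSubgroupClass.coe_sub, σ_apply, σ_apply, coe_conjSignedSat_apply, coe_conjSignedSat_apply,
      σ_apply, ← AddMonoidHom.comp_apply, conjH1_comp_scalarH1, AddMonoidHom.comp_apply]
  -- the `𝒪⟦T⟧`-structure on `Hom(Sel, ℚ/ℤ)`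
  obtain ⟨inst₀, -, hX₀, hC₀⟩ := IwasawaDualCoeff.exists_module (σ := σ) (ψ := ψ) hcomm hnil.nil (AddCircle (1 : ℚ))
  letI := inst₀
  -- transport along `toDual`
  let e : D.X ≃+ (Sel →+ AddCircle (1 : ℚ)) := AddEquiv.ofBijective D.toDual D.bijective
  have he : ∀ x, e x = D.toDual x := fun _ ↦ rfl
  let inst : Module (IwasawaAlgebraO S) D.X :=
    { smul := fun f x ↦ e.symm (f • e x)
      one_smul := fun x ↦ by
        change e.symm ((1 : IwasawaAlgebraO S) • e x) = x
        rw [one_smul, e.symm_apply_apply]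
      mul_smul := fun f g x ↦ by
        change e.symm ((f * g) • e x) = e.symm (f • e (e.symm (g • e x)))
        rw [e.apply_symm_apply, mul_smul]
      smul_zero := fun f ↦ by
        change e.symm (f • e 0) = 0
        rw [map_zero, smul_zero, map_zero]
      smul_add := fun f x y ↦ by
        change e.symm (f • e (x + y)) = e.symm (f • e x) + e.symm (f • e y)
        rw [map_add, smul_add, map_add]
      add_smul := fun f g x ↦ by
        change e.symm ((f + g) • e x) = e.symm (f • e x) + e.symm (g • e x)
        rw [add_smul, map_add]
      zero_smul := fun x ↦ by
        change e.symm ((0 : IwasawaAlgebraO S) • e x) = 0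
        rw [zero_smul, map_zero] }
  have hinst : ∀ (f : IwasawaAlgebraO S) (x : D.X), D.toDual (letI := inst; f • x) = f • D.toDual x := fun f x ↦ by
    change e (e.symm (f • e x)) = f • e x
    rw [e.apply_symm_apply]
  refine ⟨inst, fun f x ↦ ?_, fun a x s ↦ ?_⟩
  · -- both `Λ`-actions are forced through `toDual`
    apply D.bijective.1
    rw [hinst, toDual_smul_eq_smulFun D htor hstab hγ f x]
    -- the restricted structure on `Hom(Sel, ℚ/ℤ)` satisfies the two laws
    letI instΛ₀ : Module (IwasawaAlgebra p) (Sel →+ AddCircle (1 : ℚ)) := Module.compHom _ (iwasawaToIwasawaO S)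
    have key := hnil.map_smul_eq_smulFun (X' := Sel →+ AddCircle (1 : ℚ)) (AddMonoidHom.id _)
      (fun y s ↦ by
        change ((iwasawaToIwasawaO S PowerSeries.X) • y) s = y (ψ s)
        rw [iwasawaToIwasawaO, PowerSeries.map_X, hX₀])
      (fun c y s k hk ↦ by
        change ((iwasawaToIwasawaO S (PowerSeries.C c)) • y) s = (PadicInt.toZModPow k c).val • y s
        rw [iwasawaToIwasawaO, PowerSeries.map_C, hC₀, ← map_nsmul]
        congr 1
        refine Subtype.ext ?_
        rw [σ_apply, AddSubgroupClass.coe_nsmul]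
        -- `scalarH1 (ι₀ c) s = (c mod p^k) • s` on the `p^k`-torsion class `s`
        have hks : p ^ k • (s : subgroupH1 κ.kerSubgroup M) = 0 := by
          rw [← AddSubgroupClass.coe_nsmul, hk, ZeroMemClass.coe_zero]
        exact scalarH1_padicInt_apply_of_pow_smul_eq_zero κ.kerSubgroup M (padicIntToCoeffIntegers S) c hks)
      f (D.toDual x)
    exact key
  · rw [hinst, hC₀]
    rfl

end Structure

end Summit.BirchSwinnertonDyer.BirchSwinnertonDyer.Theorems.SmallImageCharSignedSelmer

end
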